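import Mathlib
import Summits.Ventures.PercRepro2.LocRows
import Summits.Ventures.PercRepro2.SwRow
import Summits.Ventures.PercRepro2.SwOut
import Summits.Ventures.PercRepro2.SwAllRow
import Summits.Ventures.PercRepro2.SwOutAll
import Summits.Ventures.PercRepro2.SwOutArmFlip
import Summits.Ventures.PercRepro2.SwOutArmThm
import Summits.Ventures.PercRepro2.SwOutCoreDefs
import Summits.Ventures.PercRepro2.SwOutBigBlockDefs
import Summits.Ventures.PercRepro2.SwOutMixedBaseDefs
import Summits.Ventures.PercRepro2.SwOutMixedBaseClasses
import Summits.Ventures.PercRepro2.SwOutMixedBaseHull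
import Summits.Ventures.PercRepro2.SwOutMixedBaseDual
import Summits.Ventures.PercRepro2.SwOutMixedBaseArm

/-!
# The mixed base: the far-arm and h-piece moves at a dropped point are the arm principle (blind
cell PercRepro2, night-4 g17, 2026-08-27; proofs/NIGHT4-G17.md §4⁗ (G3))

At a point with every u-arm red and `p` dropped, a red far arm `F k` and the red h-piece `Ah` are
coarse arms of the hull (`armClosed_F`, `armClosed_Ah`: their edges go inside, to `h`, to `p` — which
is outside the hull — or outside everything), so flipping one of them is a move of the raw cube
(`flip_F`, `flip_Ah`) that keeps the conditioning by the landed arm principle (`mem_tgtU_toggleF`,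
`mem_tgtU_toggleAh`) — two of the lowerness moves (G3) of the corrected abstract lemma.
-/

namespace Summit.Ventures.PercRepro2

namespace BigBlock

open Hull LocRows

variable {V : Type*} {E : Type*}

open scoped Classical

section MoveDefs

variable {ι κ : Type*}

/-- The move toggling the far arm `k`. -/
noncomputable def toggleF (k : κ) (q : Pt ι κ) : Pt ι κ :=
  (q.1, q.2.1, q.2.2.1, q.2.2.2.1, Function.update q.2.2.2.2 k (!q.2.2.2.2 k))

/-- The move toggling the h-piece. -/
def toggleAh (q : Pt ι κ) : Pt ι κ := (q.1, !q.2.1, q.2.2.1, q.2.2.2.1, q.2.2.2.2)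

end MoveDefs

section Moves

variable {ends : E → Sym2 V} {σ : Config E} {h u p : V} {ι κ : Type*} {U : ι → Set V} {Ah : Set V}
  {F : κ → Set V} (hb : MixedBase ends σ h u p U Ah F)
include hb

/-- **Flipping the far arm `k` is the move `toggleF k`.** -/
theorem MixedBase.flip_F (k : κ) (q : Pt ι κ) :
    flip ends (F k) (mixedReal ends u p U Ah F σ q) =
      mixedReal ends u p U Ah F σ (toggleF k q) := by
  funext e
  by_cases hk : e ∈ touches ends (F k)
  · rw [flip_apply_of_mem hk, hb.mixedReal_apply_F hk, hb.mixedReal_apply_F hk]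
    simp only [toggleF, Function.update_self]
    by_cases hq : q.2.2.2.2 k = true <;> simp [hq]
  · rw [flip_apply_of_notMem hk]
    by_cases hU : ∃ j, e ∈ touches ends (U j)
    · obtain ⟨j, hj⟩ := hU
      rw [hb.mixedReal_apply_U hj, hb.mixedReal_apply_U hj]; rfl
    by_cases hA : e ∈ touches ends Ah
    · rw [hb.mixedReal_apply_Ah hA, hb.mixedReal_apply_Ah hA]; rfl
    by_cases hUP : e ∈ clsUP ends u p
    · rw [hb.mixedReal_apply_UP hUP, hb.mixedReal_apply_UP hUP]; rfl
    by_cases hX : e ∈ clsExt ends u p Ah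
    · rw [hb.mixedReal_apply_Ext hX, hb.mixedReal_apply_Ext hX]; rfl
    by_cases hF : ∃ k', e ∈ touches ends (F k')
    · obtain ⟨k', hk'⟩ := hF
      have hne : k' ≠ k := by rintro rfl; exact hk hk'
      rw [hb.mixedReal_apply_F hk', hb.mixedReal_apply_F hk']
      simp only [toggleF, Function.update_of_ne hne]
    · simp only [not_exists] at hU hF
      rw [MixedBase.mixedReal_apply_none hU hA hUP hX hF,
        MixedBase.mixedReal_apply_none hU hA hUP hX hF]

/-- **Flipping the h-piece is the move `toggleAh`.** -/
theorem MixedBase.flip_Ah (q : Pt ι κ) :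
    flip ends Ah (mixedReal ends u p U Ah F σ q) = mixedReal ends u p U Ah F σ (toggleAh q) := by
  funext e
  by_cases hA : e ∈ touches ends Ah
  · rw [flip_apply_of_mem hA, hb.mixedReal_apply_Ah hA, hb.mixedReal_apply_Ah hA]
    simp only [toggleAh]
    by_cases hq : q.2.1 = true <;> simp [hq]
  · rw [flip_apply_of_notMem hA]
    by_cases hU : ∃ j, e ∈ touches ends (U j)
    · obtain ⟨j, hj⟩ := hU
      rw [hb.mixedReal_apply_U hj, hb.mixedReal_apply_U hj]; rfl
    by_cases hUP : e ∈ clsUP ends u p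
    · rw [hb.mixedReal_apply_UP hUP, hb.mixedReal_apply_UP hUP]; rfl
    by_cases hX : e ∈ clsExt ends u p Ah
    · rw [hb.mixedReal_apply_Ext hX, hb.mixedReal_apply_Ext hX]; rfl
    by_cases hF : ∃ k, e ∈ touches ends (F k)
    · obtain ⟨k, hk⟩ := hF
      rw [hb.mixedReal_apply_F hk, hb.mixedReal_apply_F hk]; rfl
    · simp only [not_exists] at hU hF
      rw [MixedBase.mixedReal_apply_none hU hA hUP hX hF,
        MixedBase.mixedReal_apply_none hU hA hUP hX hF]

/-- A vertex outside `{h, u, p}` and the arms is not in the hull at a dropped point. -/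
lemma MixedBase.not_mem_hull_of_out [Nonempty ι] (hup : ∃ e, ends e = s(u, p)) {q : Pt ι κ}
    (hs : ∀ j, q.1 j = true) (huP : q.2.2.1 = false) {y : V} (hyh : y ≠ h) (hyu : y ≠ u)
    (hout : y ∉ armsAll U Ah F) :
    y ∉ hull ends (mixedReal ends u p U Ah F σ q) h := by
  rintro (hy | hy)
  · rw [hb.cluster_top hup hs huP] at hy
    rcases hy with hyh' | ⟨j, hj⟩ | hyu' | ⟨_, hA⟩ | ⟨k, _, hF⟩
    · exact hyh hyh'
    · exact hout (Or.inl (Or.inl (Set.mem_iUnion.2 ⟨j, hj⟩)))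
    · exact hyu hyu'
    · exact hout (Or.inl (Or.inr hA))
    · exact hout (Or.inr (Set.mem_iUnion.2 ⟨k, hF⟩))
  · rw [hb.cluster_blue_top hup hs] at hy
    rcases hy with hyh' | ⟨_, hA⟩ | ⟨k, _, hF⟩
    · exact hyh hyh'
    · exact hout (Or.inl (Or.inr hA))
    · exact hout (Or.inr (Set.mem_iUnion.2 ⟨k, hF⟩))

/-- `p` is not in the hull at a dropped point. -/
lemma MixedBase.p_not_mem_hull [Nonempty ι] (hup : ∃ e, ends e = s(u, p)) {q : Pt ι κ}
    (hs : ∀ j, q.1 j = true) (huP : q.2.2.1 = false) :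
    p ∉ hull ends (mixedReal ends u p U Ah F σ q) h := by
  rintro (hy | hy)
  · rw [hb.cluster_top hup hs huP] at hy
    rcases hy with hyh' | ⟨j, hj⟩ | hyu' | ⟨_, hA⟩ | ⟨k, _, hF⟩
    · exact hb.hne_hp hyh'.symm
    · exact hb.p_notMem_U j hj
    · exact hb.hne_up hyu'.symm
    · exact hb.p_notMem_Ah hA
    · exact hb.p_notMem_F k hF
  · rw [hb.cluster_blue_top hup hs] at hy
    rcases hy with hyh' | ⟨_, hA⟩ | ⟨k, _, hF⟩
    · exact hb.hne_hp hyh'.symm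
    · exact hb.p_notMem_Ah hA
    · exact hb.p_notMem_F k hF

/-- **A red far arm is a union of arms of the hull** at a dropped point. -/
theorem MixedBase.armClosed_F [Nonempty ι] (hup : ∃ e, ends e = s(u, p)) {q : Pt ι κ}
    (hs : ∀ j, q.1 j = true) (huP : q.2.2.1 = false) {k : κ} (hk : q.2.2.2.2 k = true) :
    ArmClosed ends (mixedReal ends u p U Ah F σ q) h (F k) where
  subset := by
    intro x hx
    refine ⟨Or.inl ?_, fun hxh => hb.h_notMem_F k (hxh ▸ hx)⟩
    rw [hb.cluster_top hup hs huP]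
    exact Or.inr (Or.inr (Or.inr (Or.inr ⟨k, hk, hx⟩)))
  closed := by
    intro e x y hxy hx hy hyh
    obtain ⟨x', y', hxy', hx', hy'⟩ := hb.ends_of_touches_F ⟨x, hx, y, hxy⟩
    rw [hxy, Sym2.eq_iff] at hxy'
    rcases hxy' with ⟨h1, h2⟩ | ⟨h1, h2⟩
    · rw [← h2] at hy'
      rcases hy' with hy' | hy' | ⟨hyh', hyu, _, hout⟩
      · exact hy'
      · exact absurd hy' hyh
      · exact absurd hy (hb.not_mem_hull_of_out hup hs huP hyh' hyu hout)
    · rw [← h2] at hx'; exact hx'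

/-- **The red h-piece is a union of arms of the hull** at a dropped point. -/
theorem MixedBase.armClosed_Ah [Nonempty ι] (hup : ∃ e, ends e = s(u, p)) {q : Pt ι κ}
    (hs : ∀ j, q.1 j = true) (huP : q.2.2.1 = false) (ha : q.2.1 = true) :
    ArmClosed ends (mixedReal ends u p U Ah F σ q) h Ah where
  subset := by
    intro x hx
    refine ⟨Or.inl ?_, fun hxh => hb.h_notMem_Ah (hxh ▸ hx)⟩
    rw [hb.cluster_top hup hs huP]
    exact Or.inr (Or.inr (Or.inr (Or.inl ⟨ha, hx⟩)))
  closed := by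
    intro e x y hxy hx hy hyh
    obtain ⟨x', y', hxy', hx', hy'⟩ := hb.ends_of_touches_Ah ⟨x, hx, y, hxy⟩
    rw [hxy, Sym2.eq_iff] at hxy'
    rcases hxy' with ⟨h1, h2⟩ | ⟨h1, h2⟩
    · rw [← h2] at hy'
      rcases hy' with hy' | hy' | hyp | ⟨hyh', hyu, _, hout⟩
      · exact hy'
      · exact absurd hy' hyh
      · rw [hyp] at hy; exact absurd hy (hb.p_not_mem_hull hup hs huP)
      · exact absurd hy (hb.not_mem_hull_of_out hup hs huP hyh' hyu hout)
    · rw [← h2] at hx'; exact hx'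

/-- **The far-arm move keeps the conditioning** at a dropped point (the arm principle). -/
theorem MixedBase.mem_tgtU_toggleF [Fintype E] [DecidableEq E] [Nonempty ι]
    (hup : ∃ e, ends e = s(u, p)) {Us : Set V} {l o : V} (hl : l ∉ Us) {q : Pt ι κ}
    (hs : ∀ j, q.1 j = true) (huP : q.2.2.1 = false) {k : κ} (hk : q.2.2.2.2 k = true)
    (hFU : F k ⊆ Us) (hQ : mixedReal ends u p U Ah F σ q ∈ tgtU ends l h {S : Set V | o ∈ S}) :
    mixedReal ends u p U Ah F σ (toggleF k q) ∈ tgtU ends l h {S : Set V | o ∈ S} := by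
  rw [← hb.flip_F]
  refine flip_mem_tgtU_of_armClosed_red (hb.coreFree_top hup hs huP) (hb.armClosed_F hup hs huP hk)
    ?_ hFU hl hQ
  intro x hx
  rw [hb.cluster_top hup hs huP]
  exact Or.inr (Or.inr (Or.inr (Or.inr ⟨k, hk, hx⟩)))

/-- **The h-piece move keeps the conditioning** at a dropped point (the arm principle). -/
theorem MixedBase.mem_tgtU_toggleAh [Fintype E] [DecidableEq E] [Nonempty ι]
    (hup : ∃ e, ends e = s(u, p)) {Us : Set V} {l o : V} (hl : l ∉ Us) {q : Pt ι κ}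
    (hs : ∀ j, q.1 j = true) (huP : q.2.2.1 = false) (ha : q.2.1 = true) (hAU : Ah ⊆ Us)
    (hQ : mixedReal ends u p U Ah F σ q ∈ tgtU ends l h {S : Set V | o ∈ S}) :
    mixedReal ends u p U Ah F σ (toggleAh q) ∈ tgtU ends l h {S : Set V | o ∈ S} := by
  rw [← hb.flip_Ah]
  refine flip_mem_tgtU_of_armClosed_red (hb.coreFree_top hup hs huP) (hb.armClosed_Ah hup hs huP ha)
    ?_ hAU hl hQ
  intro x hx
  rw [hb.cluster_top hup hs huP]
  exact Or.inr (Or.inr (Or.inr (Or.inl ⟨ha, hx⟩)))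

end Moves

end BigBlock

end Summit.Ventures.PercRepro2
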